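import Summits.KontsevichZagierPeriods.KontsevichZagierPeriods.Theses.MellinCoarea
import Summits.KontsevichZagierPeriods.KontsevichZagierPeriods.Theorems.K2SymbolChainsJensenIsScissorsLastCoord
import Literature.NumberTheory.Transcendental.KZCalculus
import Literature.NumberTheory.Transcendental.SemialgebraicMaps

/-!
# `CoareaShear` (stmt-KontsevichZagierPeriods-5084, route MellinCoarea) — proof

The coarea move is ONE instance of Kontsevich–Zagier's rule (2) (`KZ.changeOfVariablesRel`): for a
level function `F`, `ℚ`-semialgebraic on `r.domain ⊆ ℝⁿ⁺¹` with a derivative `F' x` within the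
domain, the shear `Φ(x) = (init x, F x)` (replace the last coordinate by the level) is a
`ℚ`-semialgebraic map (its coordinates are `n` coordinate functions and `F`), has derivative
`Φ' x : w ↦ (init w, F' x w)` within the domain (componentwise), and `det Φ' x = F' x (e_last)`
because the matrix of `Φ' x` is block lower-triangular `[[I, 0], [*, ∂F/∂x_last]]` — this
determinant is the tree lemma `det_lastCoordDeriv` (toolkit III of `JensenIsScissors`, itself
`LinearMap.det_of_snoc_init` of `KZLogCalculusProofs`). With injectivity of `Φ`, the image
condition `r'.domain = Φ(r.domain)` and the integrand identity
`r.integrand x = r'.integrand (Φ x)·|F' x (e_last)|` given as hypotheses, the six clauses of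
`KZ.changeOfVariablesRel` are met literally. No definitions.
-/

noncomputable section

open Set
open Literature.NumberTheory.Transcendental
open Literature.ModelTheory.ExponentialFields (IsSemialgebraic)
open MvPolynomial (X)
open Summit.KontsevichZagierPeriods.K2SymbolChains.JensenIsScissorsProof (det_lastCoordDeriv)

namespace Summit.KontsevichZagierPeriods.MellinCoarea

variable {n : ℕ}

/-- The shear `x ↦ (init x, F x)` is a `ℚ`-semialgebraic map on a `ℚ`-semialgebraic `D` as soon as
`F` is a `ℚ`-semialgebraic function on `D`: its coordinates are the coordinate functions
`x (castSucc j)` and `F` (finite intersection of cylinders over the coordinate graphs, no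
Tarski–Seidenberg needed). [cite: BochnakCosteRoy1998, §2.2] -/
theorem isSemialgebraicMapOn_shear {D : Set (Fin (n + 1) → ℝ)} {F : (Fin (n + 1) → ℝ) → ℝ}
    (hD : IsSemialgebraic ℚ D) (hF : IsSemialgebraicFunOn ℚ D F) :
    IsSemialgebraicMapOn ℚ D (fun x => (Fin.snoc (Fin.init x) (F x) : Fin (n + 1) → ℝ)) := by
  refine IsSemialgebraicMapOn.of_forall hD fun i => ?_
  refine Fin.lastCases ?_ (fun j => ?_) i
  · exact hF.congr fun z _ => by simp
  · exact (isSemialgebraicFunOn_aeval hD (X (Fin.castSucc j) : MvPolynomial (Fin (n + 1)) ℚ)).congr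
      fun z _ => by simp [Fin.init]

/-- The shear `x ↦ (init x, F x)` has derivative `w ↦ (init w, F'ₓ w)` within `D` at `x` whenever
`F` has derivative `F'ₓ` within `D` at `x` (componentwise: the first `n` coordinates are
coordinate projections, their own derivatives; the last is `F`). [folklore] -/
theorem hasFDerivWithinAt_shear {D : Set (Fin (n + 1) → ℝ)} {F : (Fin (n + 1) → ℝ) → ℝ}
    {F'x : (Fin (n + 1) → ℝ) →L[ℝ] ℝ} {x : Fin (n + 1) → ℝ} (hF : HasFDerivWithinAt F F'x D x) :
    HasFDerivWithinAt (fun x => (Fin.snoc (Fin.init x) (F x) : Fin (n + 1) → ℝ))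
      (ContinuousLinearMap.pi (Fin.lastCases (motive := fun _ => (Fin (n + 1) → ℝ) →L[ℝ] ℝ) F'x
        (fun i => ContinuousLinearMap.proj (Fin.castSucc i)))) D x := by
  refine hasFDerivWithinAt_pi'' fun i => ?_
  refine Fin.lastCases ?_ (fun j => ?_) i
  · have hfun : (fun x : Fin (n + 1) → ℝ =>
        (Fin.snoc (Fin.init x) (F x) : Fin (n + 1) → ℝ) (Fin.last n)) = F := by
      funext x
      simp
    rw [hfun]
    refine hF.congr_fderiv (ContinuousLinearMap.ext fun w => ?_)
    simp
  · have hfun : (fun x : Fin (n + 1) → ℝ =>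
        (Fin.snoc (Fin.init x) (F x) : Fin (n + 1) → ℝ) (Fin.castSucc j)) =
        fun x => x (Fin.castSucc j) := by
      funext x
      simp [Fin.init]
    rw [hfun]
    refine (hasFDerivWithinAt_apply (Fin.castSucc j) x D).congr_fderiv
      (ContinuousLinearMap.ext fun w => ?_)
    simp

/-- **`CoareaShear`** (route MellinCoarea, stmt-KontsevichZagierPeriods-5084): for representations
`r, r'` of dimension `n + 1`, a level function `F` which is `ℚ`-semialgebraic on `r.domain` with
derivative `F' x` within `r.domain` at each of its points, the shear `Φ(x) = (init x, F x)`
injective on `r.domain`, `r'.domain = Φ(r.domain)` and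
`r.integrand x = r'.integrand (Φ x)·|F' x (e_last)|` on `r.domain`, the difference `[r] − [r']`
lies in `KZ.changeOfVariablesRel`. Proof: instantiate rule (2) with `Φ` and
`Φ' x : w ↦ (init w, F' x w)`; `Φ` is a semialgebraic map (`isSemialgebraicMapOn_shear`), `Φ' x`
is its derivative within the domain (`hasFDerivWithinAt_shear`), and
`det Φ' x = F' x (e_last)` (`det_lastCoordDeriv`, block lower-triangular).
[cite: KontsevichZagier2001, §1.2 rule (2)] -/
theorem coareaShear_proof :
    Summit.KontsevichZagierPeriods.KontsevichZagierPeriods.Theses.MellinCoarea.CoareaShear := by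
  intro n r r' F F' hF hF' hinj hdom hint
  refine ⟨n + 1, r, r', fun x => (Fin.snoc (Fin.init x) (F x) : Fin (n + 1) → ℝ),
    fun x => ContinuousLinearMap.pi
      (Fin.lastCases (motive := fun _ => (Fin (n + 1) → ℝ) →L[ℝ] ℝ) (F' x)
        (fun i => ContinuousLinearMap.proj (Fin.castSucc i))),
    isSemialgebraicMapOn_shear r.isSemialgebraic_domain hF,
    fun x hx => hasFDerivWithinAt_shear (hF' x hx), hinj, hdom, fun x hx => ?_, rfl⟩
  beta_reduce
  rw [hint x hx, det_lastCoordDeriv]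

end Summit.KontsevichZagierPeriods.MellinCoarea

end
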